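import Literature.AlgebraicGeometry.ComplexMultiplication.PrincipalModelOfCMOrder
import Literature.AlgebraicGeometry.Motives.AbelianVarietySimpleFactorsUnique
import Literature.NumberTheory.DiophantineGeometry.AVIsogenyTateHoldsProofs
import Mathlib.RingTheory.TensorProduct.Pi
import Mathlib.RingTheory.TensorProduct.Maps
import Mathlib.LinearAlgebra.Dimension.Constructions
import Mathlib.LinearAlgebra.Basis.VectorSpace
import HarnessLib

/-!
# `End⁰` of an orthogonal biproduct of abelian varieties is the product of the `End⁰`

D. Mumford, *Abelian Varieties* (1970), §19, Corollary 2 of Theorem 3 and p. 174: if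
`X ∼ A₁^{n₁} × ⋯ × A_k^{n_k}` with the `A_i` simple and pairwise non-isogenous, then
«`End⁰(X) = ⊕ᵢ M_{nᵢ}(Dᵢ)`, `Dᵢ = End⁰(Aᵢ)`»; the first half of this is the statement that `End⁰` of a
product of abelian varieties WITHOUT non-zero homomorphisms between distinct factors is the product of
the `End⁰` of the factors (G. Shimura, *Abelian Varieties with Complex Multiplication and Modular
Functions* (1998), §5.1, proof of Proposition 3, held chunk p0048: «`End_Q(A)` is identified with the
direct sum of the `ℜ_i`»).  The second half (`End⁰(B^m) = M_m(End⁰ B)`) is the tree's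
`Summits/HodgeConjecture/CorCM/EndAlgebraPowerMatrix`.

This file PROVES, for a finite family `A : ι → AbelianVariety k` over ANY field `k` which is
ORTHOGONAL (`Hom(A i, A j) = 0` for `i ≠ j`):

* §1 `End`-level: every endomorphism of `⨁ A` is the biproduct of its diagonal components
  (`biproduct_map_diag_eq`), so `G ↦ (ι_i ≫ G ≫ π_i)_i` is a ring isomorphism
  `End(⨁ A) ≅ ∏ᵢ End(A i)` (`exists_ringEquiv_end_biproduct_pi`).
* §2 `End⁰`-level: `End⁰(⨁ A) ≃ₐ[ℚ] ∏ᵢ End⁰(A i)` (`nonempty_algEquiv_endAlgebra_biproduct_pi`, through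
  `ℚ ⊗_ℤ ∏ᵢ End(A i) ≅ ∏ᵢ ℚ ⊗_ℤ End(A i)`, Mathlib `Algebra.TensorProduct.piRight`), hence
  `finrank_endAlgebra_biproduct_eq_sum` (`dim_ℚ End⁰(⨁ A) = Σᵢ dim_ℚ End⁰(A i)`) and
  `endAlgebra_biproduct_comm_iff` (`End⁰(⨁ A)` is commutative iff every `End⁰(A i)` is).
* §3 orthogonality of pairwise non-isogenous SIMPLE abelian varieties over an algebraically closed field
  (`orthogonal_of_isSimple_of_not_isIsogenous`, from the tree's `hsimple_of_isAlgClosed`: a non-zero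
  homomorphism between simple abelian varieties is an isogeny), and of biproducts of orthogonal
  families (`hom_biproduct_eq_zero`).

## References
* [MumfordAV1970] D. Mumford, *Abelian Varieties*, TIFR Studies in Math. 5 (1970), §19 Thm. 3,
  Cor. 1–2 and p. 174.
* [Shimura1998] G. Shimura, *Abelian Varieties with Complex Multiplication and Modular Functions*
  (1998), §5.1, proof of Proposition 3 (held chunk p0048).

## Design
Theorems only (the ring isomorphism and the `ℚ`-algebra isomorphism are produced existentially /
as `Nonempty`, built inside the proofs with `RingEquiv.ofBijective`-free explicit inverses, Mathlib
`AlgEquiv.ofRingEquiv`, `Algebra.TensorProduct.congr`, `Algebra.TensorProduct.piRight`).  `Module.Free ℚ`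
on `End⁰` is supplied by hand (`@Module.Free.of_divisionRing _ _ _ Ring.toAddCommGroup Algebra.toModule`:
instance search does not bridge the two `AddCommMonoid` paths of `endAlgebra.instRing`).
-/

noncomputable section

open CategoryTheory CategoryTheory.Limits
open scoped TensorProduct

namespace Literature.AlgebraicGeometry.Motives

namespace AbelianVariety

universe u

variable {k : Type u} [Field k] {ι : Type} [Fintype ι] [DecidableEq ι] {A : ι → AbelianVariety k}

/-! ## §1 Endomorphisms of an orthogonal biproduct are diagonal -/

/-- The `(j, l)` component `ι_j ≫ biproduct.map f ≫ π_l` of a diagonal endomorphism: `f j` on the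
diagonal, `0` off it. [cite: MumfordAV1970, §19 (p. 174)] -/
theorem ι_map_π (f : ∀ i, A i ⟶ A i) (j l : ι) :
    biproduct.ι A j ≫ biproduct.map f ≫ biproduct.π A l =
      if h : j = l then f j ≫ eqToHom (congrArg A h) else 0 := by
  rw [biproduct.ι_map_assoc, biproduct.ι_π]
  split_ifs with h
  · subst h
    simp
  · rw [comp_zero]

/-- **In an ORTHOGONAL family (`Hom(A j, A l) = 0` for `j ≠ l`) every endomorphism of `⨁ A` is the
biproduct of its diagonal components**: `G = ⨁ᵢ (ι_i ≫ G ≫ π_i)`. [cite: MumfordAV1970, §19 (p. 174)] -/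
theorem biproduct_map_diag_eq (horth : ∀ j l, j ≠ l → ∀ f : A j ⟶ A l, f = 0) (G : (⨁ A) ⟶ ⨁ A) :
    biproduct.map (fun i => biproduct.ι A i ≫ G ≫ biproduct.π A i) = G := by
  refine biproduct.hom_ext' _ _ fun j => biproduct.hom_ext _ _ fun l => ?_
  rw [Category.assoc, ι_map_π]
  split_ifs with h
  · subst h
    simp
  · rw [Category.assoc]
    exact (horth j l h _).symm

omit [DecidableEq ι] in
/-- The diagonal components of `biproduct.map f` are the `f i`. [cite: MumfordAV1970, §19 (p. 174)] -/
theorem ι_map_π_self (f : ∀ i, A i ⟶ A i) (i : ι) :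
    biproduct.ι A i ≫ biproduct.map f ≫ biproduct.π A i = f i := by
  rw [biproduct.ι_map_assoc, biproduct.ι_π_self, Category.comp_id]

omit [DecidableEq ι] in
/-- `biproduct.map` is multiplicative for the `End` multiplication (`x * y = y ≫ x`).
[cite: MumfordAV1970, §19 (p. 174)] -/
theorem biproduct_map_comp' (f g : ∀ i, A i ⟶ A i) :
    biproduct.map f ≫ biproduct.map g = biproduct.map fun i => f i ≫ g i :=
  biproduct.hom_ext _ _ fun j => by
    rw [Category.assoc, biproduct.map_π, biproduct.map_π_assoc, biproduct.map_π]

/-- **`End(⨁ A) ≅ ∏ᵢ End(A i)` for an orthogonal family**: a ring isomorphism `e` with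
`e G = (ι_i ≫ G ≫ π_i)_i` and `e⁻¹ f = ⨁ᵢ f i`. [cite: MumfordAV1970, §19 (p. 174)] -/
theorem exists_ringEquiv_end_biproduct_pi (horth : ∀ j l, j ≠ l → ∀ f : A j ⟶ A l, f = 0) :
    ∃ e : End (⨁ A) ≃+* (∀ i, End (A i)),
      (∀ G i, e G i = End.of (biproduct.ι A i ≫ End.asHom G ≫ biproduct.π A i)) ∧
        ∀ f, e.symm f = End.of (biproduct.map fun i => End.asHom (f i)) := by
  let e : End (⨁ A) ≃+* (∀ i, End (A i)) :=
    { toFun := fun G i => End.of (biproduct.ι A i ≫ End.asHom G ≫ biproduct.π A i)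
      invFun := fun f => End.of (biproduct.map fun i => End.asHom (f i))
      left_inv := fun G => biproduct_map_diag_eq horth (End.asHom G)
      right_inv := fun f => funext fun i => ι_map_π_self (fun i => End.asHom (f i)) i
      map_mul' := fun G H => funext fun i => by
        change biproduct.ι A i ≫ (End.asHom H ≫ End.asHom G) ≫ biproduct.π A i =
          (biproduct.ι A i ≫ End.asHom H ≫ biproduct.π A i) ≫ (biproduct.ι A i ≫ End.asHom G ≫ biproduct.π A i)
        conv_lhs => rw [← biproduct_map_diag_eq horth (End.asHom G), ← biproduct_map_diag_eq horth (End.asHom H)]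
        rw [Category.assoc, ← Category.assoc (biproduct.map _) (biproduct.map _), biproduct_map_comp',
          ι_map_π_self]
      map_add' := fun G H => funext fun i => by
        change biproduct.ι A i ≫ (End.asHom G + End.asHom H) ≫ biproduct.π A i = _
        rw [Preadditive.add_comp, Preadditive.comp_add]
        rfl }
  exact ⟨e, fun G i => rfl, fun f => rfl⟩

/-! ## §2 `End⁰(⨁ A) ≅ ∏ᵢ End⁰(A i)` -/

/-- **`End⁰(⨁ A) ≃ₐ[ℚ] ∏ᵢ End⁰(A i)` for an orthogonal family** (`ℚ ⊗ -` of the ring isomorphism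
`End(⨁ A) ≅ ∏ End(A i)`, and `ℚ ⊗_ℤ ∏ᵢ Rᵢ ≅ ∏ᵢ ℚ ⊗_ℤ Rᵢ` for a finite product), with
`e (1 ⊗ G) = (1 ⊗ (ι_i ≫ G ≫ π_i))_i`. [cite: MumfordAV1970, §19 (p. 174)]
[cite: Shimura1998, §5.1 (proof of Proposition 3)] -/
theorem nonempty_algEquiv_endAlgebra_biproduct_pi (horth : ∀ j l, j ≠ l → ∀ f : A j ⟶ A l, f = 0) :
    ∃ e : (⨁ A).endAlgebra ≃ₐ[ℚ] (∀ i, (A i).endAlgebra),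
      ∀ (G : End (⨁ A)) (i : ι), e (endAlgebra.of _ G) i =
        endAlgebra.of (A i) (End.of (biproduct.ι A i ≫ End.asHom G ≫ biproduct.π A i)) := by
  obtain ⟨e, he, -⟩ := exists_ringEquiv_end_biproduct_pi horth
  let eZ : End (⨁ A) ≃ₐ[ℤ] (∀ i, End (A i)) :=
    AlgEquiv.ofRingEquiv (f := e) fun x => by simp
  let E : (⨁ A).endAlgebra ≃ₐ[ℚ] (∀ i, (A i).endAlgebra) :=
    (Algebra.TensorProduct.congr (AlgEquiv.refl : ℚ ≃ₐ[ℚ] ℚ) eZ).trans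
      (Algebra.TensorProduct.piRight ℤ ℚ ℚ fun i => End (A i))
  refine ⟨E, fun G i => ?_⟩
  change (Algebra.TensorProduct.piRight ℤ ℚ ℚ (fun i => End (A i)))
      (Algebra.TensorProduct.congr (AlgEquiv.refl : ℚ ≃ₐ[ℚ] ℚ) eZ ((1 : ℚ) ⊗ₜ[ℤ] G)) i =
    (1 : ℚ) ⊗ₜ[ℤ] (End.of (biproduct.ι A i ≫ End.asHom G ≫ biproduct.π A i))
  rw [Algebra.TensorProduct.congr_apply, Algebra.TensorProduct.map_tmul, Algebra.TensorProduct.piRight_tmul]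
  change (1 : ℚ) ⊗ₜ[ℤ] (e G i) = _
  rw [he]

/-- **`dim_ℚ End⁰(⨁ A) = Σᵢ dim_ℚ End⁰(A i)` for an orthogonal family.**
[cite: MumfordAV1970, §19 Cor. 2 of Thm. 3 and p. 174] -/
theorem finrank_endAlgebra_biproduct_eq_sum (horth : ∀ j l, j ≠ l → ∀ f : A j ⟶ A l, f = 0) :
    Module.finrank ℚ (⨁ A).endAlgebra = ∑ i, Module.finrank ℚ (A i).endAlgebra := by
  obtain ⟨e, -⟩ := nonempty_algEquiv_endAlgebra_biproduct_pi horth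
  haveI : ∀ i, Module.Finite ℚ (A i).endAlgebra := fun i => finiteDimensional_endAlgebra_holds (A i)
  haveI : ∀ i, Module.Free ℚ (A i).endAlgebra := fun i =>
    @Module.Free.of_divisionRing ℚ (A i).endAlgebra _ Ring.toAddCommGroup Algebra.toModule
  rw [e.toLinearEquiv.finrank_eq, Module.finrank_pi_fintype]

/-- **`End⁰(⨁ A)` is commutative iff every `End⁰(A i)` is**, for an orthogonal family.
[cite: MumfordAV1970, §19 (p. 174)] -/
theorem endAlgebra_biproduct_comm_iff (horth : ∀ j l, j ≠ l → ∀ f : A j ⟶ A l, f = 0) :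
    (∀ x y : (⨁ A).endAlgebra, x * y = y * x) ↔ ∀ i, ∀ x y : (A i).endAlgebra, x * y = y * x := by
  obtain ⟨e, -⟩ := nonempty_algEquiv_endAlgebra_biproduct_pi horth
  constructor
  · intro h i x y
    have hx := h (e.symm (Pi.single i x)) (e.symm (Pi.single i y))
    rw [← map_mul, ← map_mul, e.symm.injective.eq_iff] at hx
    have := congrFun hx i
    simpa using this
  · intro h x y
    apply e.injective
    rw [map_mul, map_mul]
    exact funext fun i => h i _ _

/-! ## §3 Orthogonality -/

omit [Fintype ι] [DecidableEq ι] in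
/-- **Pairwise non-isogenous simple abelian varieties over an algebraically closed field are
orthogonal**: `Hom(A j, A l) = 0` for `j ≠ l` (a non-zero homomorphism between simple abelian varieties is
an isogeny, the tree's `hsimple_of_isAlgClosed`). [cite: MumfordAV1970, §19 Cor. 2 of Thm. 3] -/
theorem orthogonal_of_isSimple_of_not_isIsogenous [IsAlgClosed k] (hS : ∀ i, (A i).IsSimple)
    (hni : ∀ j l, j ≠ l → ¬ IsIsogenous (A j) (A l)) :
    ∀ j l, j ≠ l → ∀ f : A j ⟶ A l, f = 0 := by
  intro j l hjl f
  by_contra hf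
  exact hni j l hjl ⟨f, hsimple_of_isAlgClosed k _ _ (hS j) (hS l) f hf⟩

/-- **`Hom` between biproducts of orthogonal families vanishes**: if `Hom(B j, C l) = 0` for all `j, l`
then `Hom(⨁ B, ⨁ C) = 0`. [cite: MumfordAV1970, §19 (p. 174)] -/
theorem hom_biproduct_eq_zero {κ κ' : Type} [Fintype κ] [DecidableEq κ] [Fintype κ'] [DecidableEq κ']
    {B : κ → AbelianVariety k} {C : κ' → AbelianVariety k} (h : ∀ j l, ∀ f : B j ⟶ C l, f = 0)
    (F : (⨁ B) ⟶ ⨁ C) : F = 0 :=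
  biproduct.hom_ext' _ _ fun j => biproduct.hom_ext _ _ fun l => by
    rw [Category.assoc, comp_zero, zero_comp]
    exact h j l _

end AbelianVariety

end Literature.AlgebraicGeometry.Motives

end
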